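import Literature.AlgebraicTopology.SingularHomology.HurewiczProofs
import Mathlib.Topology.ContinuousMap.Algebra
import HarnessLib

/-!
# `H₁` of products and of maps into topological groups

Two consequences of the Hurewicz theorem in degree one (A. Hatcher, *Algebraic Topology*, CUP
2002, Thm. 2A.1, proved in the tree: `Literature.AlgebraicTopology.SingularHomology.HurewiczProof.hurewiczOne_surjective`,
`…HurewiczProofs`) for Mathlib's singular homology `Literature.singularHomology ℤ ℤ X 1`:

* `Literature.AlgebraicTopology.SingularHomology.singularHomology.addMonoidHom_ext_loopClass`, `hom_ext_loopClass`: for a path-connected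
  space, two additive maps out of `H₁(X; ℤ)` that agree on the Hurewicz classes `h(γ)` of the
  loops at a base point are equal (loop classes generate `H₁`).
* `Literature.AlgebraicTopology.SingularHomology.loopClass_mul` (**Eckmann–Hilton for `H₁`**): in a topological group, the pointwise
  product `α · β` of loops `α` at `a` and `β` at `b` is homotopic to the concatenation of the
  translates `α b` and `a β` (Hatcher 2002, §3.C, Ex. 5 p. 291 / proof of Lemma 3C.3: in an
  H-space "`f · g ≃ (f · e)(e · g)`"), so `h(α · β) = (· b)_* h(α) + (a ·)_* h(β)`.
* `Literature.AlgebraicTopology.SingularHomology.singularHomology.map_mul_one` (**additivity**): for continuous `f, g : X → G` into a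
  path-connected topological group, `(f · g)_* = f_* + g_*` on `H₁(-; ℤ)` (translations are
  homotopic to the identity); with `map_one_one`, `map_inv_one`, `map_pow_one`, `map_zpow_one`,
  `map_prod_one`.
* `Literature.AlgebraicTopology.SingularHomology.singularHomology.eq_map_inl_add_map_inr_one`, `isIso_prodDesc_one` (**`H₁` of a product**,
  the degree-one case of the Künneth formula, Hatcher 2002, §3.B Thm. 3B.6, here from 2A.1: a
  loop `(α, β)` in `X × Y` is homotopic to `(α, y₀) · (x₀, β)`): for path-connected `X`, `Y`,
  `H₁(X; ℤ) ⊞ H₁(Y; ℤ) ⟶ H₁(X × Y; ℤ)`, `(a, b) ↦ (-, y₀)_* a + (x₀, -)_* b`, is an isomorphism with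
  inverse `(pr₁_*, pr₂_*)`.

Everything is proved; there are no new definitions.

## References

* A. Hatcher, *Algebraic Topology*, CUP 2002, §2.A Thm. 2A.1; §3.B Thm. 3B.6; §3.C Lemma 3C.3 and
  Ex. 5 [HatcherAT2002].
-/

noncomputable section

open CategoryTheory Limits

universe u v

namespace Literature.AlgebraicTopology.SingularHomology

variable {X Y : Type u} [TopologicalSpace X] [TopologicalSpace Y]

/-! ### Loop classes generate `H₁(X; ℤ)` -/

section Ext

variable [PathConnectedSpace X]

/-- **Loop classes generate `H₁`**: for a path-connected space `X` with base point `x₀`, two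
additive maps `H₁(X; ℤ) → A` which agree on the Hurewicz classes `h(γ)`, `γ` a loop at `x₀`, are
equal (the Hurewicz homomorphism is onto, Hatcher Thm. 2A.1, `hurewiczOne_surjective`).
[cite: HatcherAT2002, Thm. 2A.1] -/
theorem singularHomology.addMonoidHom_ext_loopClass (x₀ : X) {A : Type*} [AddZeroClass A]
    {φ ψ : singularHomology ℤ ℤ X 1 →+ A}
    (h : ∀ γ : Path x₀ x₀, φ (loopClass ℤ ℤ (1 : ℤ) γ) = ψ (loopClass ℤ ℤ (1 : ℤ) γ)) : φ = ψ := by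
  ext y
  obtain ⟨g, hg⟩ := HurewiczProof.hurewiczOne_surjective x₀ (Multiplicative.ofAdd y)
  induction g using Path.Homotopic.Quotient.ind with | mk p =>
  have hy : loopClass ℤ ℤ (1 : ℤ) p = y := by
    have h' := congrArg Multiplicative.toAdd hg
    rwa [toAdd_ofAdd] at h'
  rw [← hy]
  exact h p

/-- `ModuleCat` form of `addMonoidHom_ext_loopClass`: two morphisms `H₁(X; ℤ) ⟶ A` which agree on
loop classes at a base point are equal. [cite: HatcherAT2002, Thm. 2A.1] -/
theorem singularHomology.hom_ext_loopClass (x₀ : X) {A : ModuleCat.{u} ℤ}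
    {φ ψ : singularHomology ℤ ℤ X 1 ⟶ A}
    (h : ∀ γ : Path x₀ x₀, φ (loopClass ℤ ℤ (1 : ℤ) γ) = ψ (loopClass ℤ ℤ (1 : ℤ) γ)) : φ = ψ := by
  ext1
  apply LinearMap.toAddMonoidHom_injective
  exact singularHomology.addMonoidHom_ext_loopClass x₀ h

end Ext

/-! ### Eckmann–Hilton: the Hurewicz class of a pointwise product of loops -/

section TopGroup

variable (R : Type v) [CommRing R] (M : Type v) [AddCommGroup M] [Module R M] (m : M)
variable {G : Type u} [TopologicalSpace G] [Group G] [IsTopologicalGroup G]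

/-- In a topological group, `(α · refl a) ⬝ … `: the pointwise product of `α ⬝ refl` and
`refl ⬝ β` *is* the concatenation of the right translate `α b` and the left translate `a β`
(Hatcher 2002, proof of Lemma 3C.3 / §3.C Ex. 5). [cite: HatcherAT2002, §3.C Lemma 3C.3] -/
theorem Path.trans_refl_mul_refl_trans {a b : G} (α : Path a a) (β : Path b b) :
    Path.mul (α.trans (Path.refl a)) ((Path.refl b).trans β) =
      (α.map (continuous_mul_const b)).trans (β.map (continuous_const_mul a)) := by
  rw [Path.mul, ← Path.trans_prod_eq_prod_trans, Path.map_trans]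
  congr 1

/-- Pointwise products of homotopic loops are homotopic. [folklore] -/
theorem Path.Homotopic.mul_mul {a b : G} {α α' : Path a a} {β β' : Path b b}
    (hα : α.Homotopic α') (hβ : β.Homotopic β') : (Path.mul α β).Homotopic (Path.mul α' β') := by
  obtain ⟨F⟩ := hα
  obtain ⟨H⟩ := hβ
  exact Path.Homotopic.map ⟨Path.Homotopic.prodHomotopy F H⟩ ⟨_, continuous_mul⟩

/-- **Eckmann–Hilton for the Hurewicz class**: in a topological group,
`h(α · β) = (· b)_* h(α) + (a ·)_* h(β)` for loops `α` at `a`, `β` at `b` and their pointwise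
product `α · β` (a loop at `a b`): `α · β ≃ (α ⬝ refl) · (refl ⬝ β) = (α b) ⬝ (a β)`
(Hatcher 2002, §3.C, Ex. 5 / Lemma 3C.3). [cite: HatcherAT2002, §3.C Lemma 3C.3] -/
theorem loopClass_mul {a b : G} (α : Path a a) (β : Path b b) :
    loopClass R M m (Path.mul α β) =
      singularHomology.map R M ⟨(· * b), continuous_mul_const b⟩ 1 (loopClass R M m α) +
        singularHomology.map R M ⟨(a * ·), continuous_const_mul a⟩ 1 (loopClass R M m β) := by
  have h1 : (Path.mul α β).Homotopic (Path.mul (α.trans (Path.refl a)) ((Path.refl b).trans β)) :=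
    Path.Homotopic.mul_mul ⟨(Path.Homotopy.transRefl α).symm⟩ ⟨(Path.Homotopy.reflTrans β).symm⟩
  rw [loopClass_eq_of_homotopic R M m h1, Path.trans_refl_mul_refl_trans, loopClass_trans,
    map_loopClass, map_loopClass]

variable [PathConnectedSpace G]

/-- In a path-connected topological group, right translation is homotopic to the identity.
[folklore] -/
theorem ContinuousMap.homotopic_mulRight_id (b : G) :
    ContinuousMap.Homotopic (⟨(· * b), continuous_mul_const b⟩ : C(G, G)) (ContinuousMap.id G) := by
  let p : Path b 1 := PathConnectedSpace.somePath b 1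
  exact ⟨{ toFun := fun tg => tg.2 * p tg.1
           continuous_toFun := by fun_prop
           map_zero_left := fun g => by simp
           map_one_left := fun g => by simp }⟩

/-- In a path-connected topological group, left translation is homotopic to the identity.
[folklore] -/
theorem ContinuousMap.homotopic_mulLeft_id (a : G) :
    ContinuousMap.Homotopic (⟨(a * ·), continuous_const_mul a⟩ : C(G, G)) (ContinuousMap.id G) := by
  let p : Path a 1 := PathConnectedSpace.somePath a 1
  exact ⟨{ toFun := fun tg => p tg.1 * tg.2
           continuous_toFun := by fun_prop
           map_zero_left := fun g => by simp
           map_one_left := fun g => by simp }⟩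

/-- In a path-connected topological group, `h(α · β) = h(α) + h(β)` for loops `α` at `a` and `β`
at `b` (the translations act trivially on homology). [cite: HatcherAT2002, §3.C Lemma 3C.3] -/
theorem loopClass_mul_eq_add {a b : G} (α : Path a a) (β : Path b b) :
    loopClass R M m (Path.mul α β) = loopClass R M m α + loopClass R M m β := by
  rw [loopClass_mul, singularHomology.map_eq_of_homotopic R M (ContinuousMap.homotopic_mulRight_id b),
    singularHomology.map_eq_of_homotopic R M (ContinuousMap.homotopic_mulLeft_id a),
    singularHomology.map_id]
  rfl

end TopGroup

/-! ### Additivity of `H₁` for maps into a topological group -/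

section Additivity

variable {G : Type u} [TopologicalSpace G] [Group G] [IsTopologicalGroup G]
variable [PathConnectedSpace X] [PathConnectedSpace G]

/-- **`(f · g)_* = f_* + g_*` on `H₁(-; ℤ)`** for continuous maps `f, g : X → G` into a
path-connected topological group (on a loop class: `(f·g) ∘ γ = (f ∘ γ) · (g ∘ γ)` and
Eckmann–Hilton, `loopClass_mul_eq_add`; loop classes generate, Hatcher Thm. 2A.1).
[cite: HatcherAT2002, §3.C Lemma 3C.3] -/
theorem singularHomology.map_mul_one (f g : C(X, G)) :
    singularHomology.map ℤ ℤ (f * g) 1 = singularHomology.map ℤ ℤ f 1 + singularHomology.map ℤ ℤ g 1 := by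
  obtain ⟨x₀⟩ : Nonempty X := inferInstance
  refine singularHomology.hom_ext_loopClass x₀ fun γ => ?_
  have e : γ.map (f * g).continuous = Path.mul (γ.map f.continuous) (γ.map g.continuous) := by
    ext t; rfl
  change _ = (singularHomology.map ℤ ℤ f 1 + singularHomology.map ℤ ℤ g 1).hom (loopClass ℤ ℤ 1 γ)
  rw [ModuleCat.hom_add, LinearMap.add_apply]
  change singularHomology.map ℤ ℤ (f * g) 1 (loopClass ℤ ℤ 1 γ) =
    singularHomology.map ℤ ℤ f 1 (loopClass ℤ ℤ 1 γ) + singularHomology.map ℤ ℤ g 1 (loopClass ℤ ℤ 1 γ)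
  rw [map_loopClass, map_loopClass, map_loopClass, e, loopClass_mul_eq_add]

/-- `1_* = 0` on `H₁(-; ℤ)` for the constant map `1 : X → G`. [folklore] -/
theorem singularHomology.map_one_one :
    singularHomology.map ℤ ℤ (1 : C(X, G)) 1 = 0 := by
  have h := singularHomology.map_mul_one (X := X) (1 : C(X, G)) 1
  rw [mul_one] at h
  exact add_eq_left.1 h.symm

/-- `(f⁻¹)_* = -f_*` on `H₁(-; ℤ)` for the pointwise inverse. [folklore] -/
theorem singularHomology.map_inv_one (f : C(X, G)) :
    singularHomology.map ℤ ℤ f⁻¹ 1 = -singularHomology.map ℤ ℤ f 1 := by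
  have h := singularHomology.map_mul_one (X := X) f f⁻¹
  rw [mul_inv_cancel, singularHomology.map_one_one] at h
  exact (neg_eq_of_add_eq_zero_right h.symm).symm

/-- `(fⁿ)_* = n • f_*` on `H₁(-; ℤ)` for pointwise powers. [folklore] -/
theorem singularHomology.map_pow_one (f : C(X, G)) (n : ℕ) :
    singularHomology.map ℤ ℤ (f ^ n) 1 = n • singularHomology.map ℤ ℤ f 1 := by
  induction n with
  | zero => rw [pow_zero, zero_smul, singularHomology.map_one_one]
  | succ n ih => rw [pow_succ, singularHomology.map_mul_one, ih, add_smul, one_smul]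

/-- `(fⁿ)_* = n • f_*` on `H₁(-; ℤ)` for pointwise integer powers. [folklore] -/
theorem singularHomology.map_zpow_one (f : C(X, G)) (n : ℤ) :
    singularHomology.map ℤ ℤ (f ^ n) 1 = n • singularHomology.map ℤ ℤ f 1 := by
  cases n with
  | ofNat n => rw [Int.ofNat_eq_natCast, zpow_natCast, singularHomology.map_pow_one, natCast_zsmul]
  | negSucc n =>
    rw [zpow_negSucc, singularHomology.map_inv_one, singularHomology.map_pow_one, negSucc_zsmul]

/-- `(∏ᵢ fᵢ)_* = ∑ᵢ (fᵢ)_*` on `H₁(-; ℤ)` for a finite pointwise product of maps into a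
path-connected commutative topological group. [folklore] -/
theorem singularHomology.map_prod_one {G : Type u} [TopologicalSpace G] [CommGroup G]
    [IsTopologicalGroup G] [PathConnectedSpace G] {ι : Type*} (s : Finset ι) (f : ι → C(X, G)) :
    singularHomology.map ℤ ℤ (∏ i ∈ s, f i) 1 = ∑ i ∈ s, singularHomology.map ℤ ℤ (f i) 1 := by
  classical
  induction s using Finset.induction_on with
  | empty => rw [Finset.prod_empty, Finset.sum_empty, singularHomology.map_one_one]
  | insert i s hi ih =>
    rw [Finset.prod_insert hi, Finset.sum_insert hi, singularHomology.map_mul_one, ih]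

end Additivity

/-! ### `H₁` of a product of path-connected spaces -/

section Product

/-- A constant map induces `0` on `Hₙ` for `n ≠ 0` (it factors through a point, whose positive
degree homology vanishes, Hatcher Prop. 2.8). [cite: HatcherAT2002, Prop. 2.8] -/
theorem singularHomology.map_const (R : Type v) [CommRing R] (M : Type v) [AddCommGroup M]
    [Module R M] (y₀ : Y) {n : ℕ} (hn : n ≠ 0) :
    singularHomology.map R M (ContinuousMap.const X y₀) n = 0 := by
  have e : ContinuousMap.const X y₀ =
      (ContinuousMap.const PUnit.{u + 1} y₀).comp (ContinuousMap.const X PUnit.unit) := by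
    ext; rfl
  rw [e, singularHomology.map_comp]
  have h0 : singularHomology.map R M (ContinuousMap.const PUnit.{u + 1} y₀) n = 0 :=
    (isZero_singularHomology_of_subsingleton R M (X := PUnit.{u + 1}) hn).eq_of_src _ _
  rw [h0, comp_zero]

variable [PathConnectedSpace X] [PathConnectedSpace Y]

/-- **`H₁` of a product, decomposition**: for path-connected `X`, `Y` with base points `x₀`,
`y₀`, every class `z ∈ H₁(X × Y; ℤ)` satisfies `z = (-, y₀)_* pr₁_* z + (x₀, -)_* pr₂_* z` (on a
loop class: `(α, β) ≃ (α ⬝ refl, refl ⬝ β) = (α, y₀) ⬝ (x₀, β)`; Hatcher Thm. 2A.1 / 3B.6).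
[cite: HatcherAT2002, Thm. 3B.6] -/
theorem singularHomology.map_inl_fst_add_map_inr_snd_one (x₀ : X) (y₀ : Y) :
    singularHomology.map ℤ ℤ (ContinuousMap.fst : C(X × Y, X)) 1 ≫
        singularHomology.map ℤ ℤ ((ContinuousMap.id X).prodMk (ContinuousMap.const X y₀)) 1 +
      singularHomology.map ℤ ℤ (ContinuousMap.snd : C(X × Y, Y)) 1 ≫
        singularHomology.map ℤ ℤ ((ContinuousMap.const Y x₀).prodMk (ContinuousMap.id Y)) 1 =
      𝟙 (singularHomology ℤ ℤ (X × Y) 1) := by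
  refine singularHomology.hom_ext_loopClass (X := X × Y) (x₀, y₀) fun γ => ?_
  -- the component loops `α = pr₁ ∘ γ`, `β = pr₂ ∘ γ`
  let α : Path x₀ x₀ := γ.map (ContinuousMap.fst : C(X × Y, X)).continuous
  let β : Path y₀ y₀ := γ.map (ContinuousMap.snd : C(X × Y, Y)).continuous
  have e : γ = α.prod β := by ext t <;> rfl
  have h1 : (α.prod β).Homotopic ((α.trans (Path.refl x₀)).prod ((Path.refl y₀).trans β)) :=
    ⟨Path.Homotopic.prodHomotopy (Path.Homotopy.transRefl α).symm (Path.Homotopy.reflTrans β).symm⟩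
  have hA : loopClass ℤ ℤ (1 : ℤ)
      (α.map ((ContinuousMap.id X).prodMk (ContinuousMap.const X y₀)).continuous) =
      loopClass ℤ ℤ 1 (α.prod (Path.refl y₀)) :=
    loopClass_eq_of_ofPath_eq ℤ ℤ 1 _ _ rfl
  have hB : loopClass ℤ ℤ (1 : ℤ)
      (β.map ((ContinuousMap.const Y x₀).prodMk (ContinuousMap.id Y)).continuous) =
      loopClass ℤ ℤ 1 ((Path.refl x₀).prod β) :=
    loopClass_eq_of_ofPath_eq ℤ ℤ 1 _ _ rfl
  have key : loopClass ℤ ℤ (1 : ℤ) γ =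
      loopClass ℤ ℤ 1 (α.prod (Path.refl y₀)) + loopClass ℤ ℤ 1 ((Path.refl x₀).prod β) := by
    rw [← loopClass_trans, Path.trans_prod_eq_prod_trans, ← loopClass_eq_of_homotopic ℤ ℤ 1 h1, ← e]
  rw [ModuleCat.id_apply]
  change ((singularHomology.map ℤ ℤ (ContinuousMap.fst : C(X × Y, X)) 1 ≫ _) +
    (singularHomology.map ℤ ℤ (ContinuousMap.snd : C(X × Y, Y)) 1 ≫ _)).hom (loopClass ℤ ℤ 1 γ) = _
  rw [ModuleCat.hom_add, LinearMap.add_apply, ModuleCat.hom_comp, ModuleCat.hom_comp,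
    LinearMap.comp_apply, LinearMap.comp_apply]
  change singularHomology.map ℤ ℤ _ 1
        (singularHomology.map ℤ ℤ (ContinuousMap.fst : C(X × Y, X)) 1 (loopClass ℤ ℤ 1 γ)) +
      singularHomology.map ℤ ℤ _ 1
        (singularHomology.map ℤ ℤ (ContinuousMap.snd : C(X × Y, Y)) 1 (loopClass ℤ ℤ 1 γ)) =
    loopClass ℤ ℤ 1 γ
  rw [map_loopClass, map_loopClass, map_loopClass, map_loopClass, key]
  exact congrArg₂ (· + ·) hA hB

/-- **`H₁(X × Y; ℤ) ≅ H₁(X; ℤ) ⊞ H₁(Y; ℤ)`** for path-connected `X`, `Y` (the degree-one Künneth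
formula, Hatcher 2002, Thm. 3B.6, obtained here from Thm. 2A.1): the map
`(a, b) ↦ (-, y₀)_* a + (x₀, -)_* b` is an isomorphism, with inverse `(pr₁_*, pr₂_*)`.
[cite: HatcherAT2002, Thm. 3B.6] -/
theorem singularHomology.isIso_prodDesc_one (x₀ : X) (y₀ : Y) :
    IsIso (biprod.desc
      (singularHomology.map ℤ ℤ ((ContinuousMap.id X).prodMk (ContinuousMap.const X y₀)) 1)
      (singularHomology.map ℤ ℤ ((ContinuousMap.const Y x₀).prodMk (ContinuousMap.id Y)) 1) :
        singularHomology ℤ ℤ X 1 ⊞ singularHomology ℤ ℤ Y 1 ⟶ singularHomology ℤ ℤ (X × Y) 1) := by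
  refine ⟨biprod.lift (singularHomology.map ℤ ℤ ContinuousMap.fst 1)
    (singularHomology.map ℤ ℤ ContinuousMap.snd 1), ?_, ?_⟩
  · have h11 : ContinuousMap.fst.comp ((ContinuousMap.id X).prodMk (ContinuousMap.const X y₀)) =
        ContinuousMap.id X := by ext; rfl
    have h12 : ContinuousMap.snd.comp ((ContinuousMap.id X).prodMk (ContinuousMap.const X y₀)) =
        ContinuousMap.const X y₀ := by ext; rfl
    have h21 : ContinuousMap.fst.comp ((ContinuousMap.const Y x₀).prodMk (ContinuousMap.id Y)) =
        ContinuousMap.const Y x₀ := by ext; rfl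
    have h22 : ContinuousMap.snd.comp ((ContinuousMap.const Y x₀).prodMk (ContinuousMap.id Y)) =
        ContinuousMap.id Y := by ext; rfl
    apply biprod.hom_ext' <;> apply biprod.hom_ext <;>
      simp only [biprod.inl_desc_assoc, biprod.inr_desc_assoc, Category.assoc, biprod.lift_fst,
        biprod.lift_snd, Category.comp_id, biprod.inl_fst, biprod.inl_snd, biprod.inr_fst,
        biprod.inr_snd, ← singularHomology.map_comp, h11, h12, h21, h22, singularHomology.map_id,
        singularHomology.map_const ℤ ℤ _ one_ne_zero]
  · rw [biprod.lift_desc]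
    exact singularHomology.map_inl_fst_add_map_inr_snd_one x₀ y₀

end Product

end Literature.AlgebraicTopology.SingularHomology
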